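import Summits.AtomisticToContinuum.BoseEinsteinCondensation.Theorems.BECGroundStateSOSPeriodicIRBoundMomentumZeroReduction
import Summits.AtomisticToContinuum.BoseEinsteinCondensation.Theorems.BECGroundStateSOSPeriodicIRBoundTwoSectorFloatingReduction
import HarnessLib

/-!
# Route `BECGroundStateSOS`, crux `PeriodicIRBound` (stmt-AtomisticToContinuum-3972), line `two-sector-gd-transfer` —
# v9 "momentum-zero test vectors, relaxed guard": vocabulary and registered stub statements of the reshaped skeleton

Third `Defs` module of the line (sequel of `…TwoSectorDefs.lean` p137770 and `…TwoSectorFloatingDefs.lean` p152359),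
written by lead seat c23 (`Cruxes/PeriodicIRBound/PICKED.md`). The v8 skeleton rests on ONE pooled stub, S1'
`FloatingTwoChannel`: the two Kennedy–Lieb–Shastry channel inequalities on the test vectors `a†(φ_n)Ψ`, `a(φ_n)Ψ` of
EVERY near-minimiser `Ψ` of `H_N`, against floating thresholds `E₀(N) + μ₊` / `E₀(N) − μ₋` with the guard `0 ≤ μ₊`.

**The reshape (v9).** The pooled load is weakened on two independent axes while the landed endgame still closes the
integrable half of the crux:

* *momentum zero.* The channel inequalities are asked only on near-minimisers of TOTAL MOMENTUM ZERO
  (`HasTotalMomentum 0 Ψ.ψ`): the KLS moment inequality and the window arithmetic then give the crux's infrared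
  inequality for momentum-zero near-minimisers (`IRBoundForZero`), which the landed normal form
  `stub_momentumZeroReduction` (p156444: c.o.m. projection, Pythagoras, complement gap; `C ↦ 2C`) upgrades to all
  near-minimisers. On such `Ψ` the test vectors lie EXACTLY in the momentum sectors `±2πn/L`
  (`WF.hasTotalMomentum_modeCr`, `WF.hasTotalMomentum_modeAn`), so the sector variational principle
  `WF.momentumSectorEnergy_mul_normSq_le` applies to them verbatim — the form mechanism provers and line 1's spectral
  floor `C⁺` speak;
* *relaxed guard.* `0 ≤ μ₊` becomes `−A·ρ ≤ μ₊` (strategist s2, `Cruxes/PeriodicIRBound/StrategistSketchS2.lean` §3):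
  the energy combination of the moment inequality is `(μ₋ − μ₊)n_k − μ₊ ≤ e·n_k + Aρ`, and `Aρ` joins the f-sum
  constant `2ρ‖v‖₁` of `WindowArith.nk_le` (`2C‖v‖₁ ↦ C(2‖v‖₁ + A)` under the square root of the window constant).

Contents: §1 `ChanPlusZero` / `ChanMinusZero` / `FloatingForZero v K ρ₀ C A` and the new pooled stub statement S1₀
`FloatingTwoChannelZero`; §2 statements of the provable v9 stubs — S4₀ `KLSNearMinimiserTZero`, S5₀
`WindowAssemblyTZero` (through `IRBoundForZero`), S9 `LinearFloorGivesFloatingZero` (line 1's `C⁺` ⇒ S1₀ per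
potential with `∫v ≠ 0`), S9' `AeZeroFloating` (`∫v = 0`); §3 sorry-free glue: restriction from the v8 vocabulary
(`floatingTwoChannelZero_of_floatingTwoChannel`, so stmt-12620 ∧ stmt-9094 ⇒ S1₀ by `stub_floatingOfPooled`),
`irBoundFor_of_irBoundForZero` (p156444), the compositions `integrableHalf_of_floatingZero` /
`periodicIRBound_of_floatingZero` (S1₀ ∧ S4₀ ∧ S5₀ [∧ S6] ⇒ integrable half [crux by name]) and
`floatingTwoChannelZero_of_linearFloor` (S9 ∧ S9' ∧ C⁺ ⇒ S1₀). Statements of a proof plan, not results in print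
(shape after Kennedy–Lieb–Shastry, J. Stat. Phys. 53 (1988) 1019, (12)–(14); sectors as in Cornean–Dereziński–Ziń,
J. Math. Phys. 50 (2009) 062103, §1.1).
-/

noncomputable section

open scoped BigOperators ENNReal ComplexConjugate
open Filter MeasureTheory

namespace Summit.AtomisticToContinuum.BoseEinsteinCondensation.Cruxes.PeriodicIRBound.TwoSectorGdTransfer

open Literature.MathematicalPhysics.QuantumManyBody.BoseGas
open Summit.AtomisticToContinuum.BoseEinsteinCondensation.Theses.BECGroundStateSOS (PeriodicIRBound)
open Summit.AtomisticToContinuum.BoseEinsteinCondensation.Theses.BECTwoSectorGD (GaussianDomination)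
open Summit.AtomisticToContinuum.BoseEinsteinCondensation.Theses.BECSectorPoincareTwoScale (EnergyConvexityWindow)
open Summit.AtomisticToContinuum.BoseEinsteinCondensation.Theorems.PeriodicIRBound.Negative
  (IRBoundFor IRBoundWith NearMin InWindow IRIneq irBoundFor_iff periodicIRBound_iff_split)
open Summit.AtomisticToContinuum.BoseEinsteinCondensation.Cruxes.PeriodicIRBound.LinearPhFloorWagner
  (LinearFloorFor LinearParticleHoleFloor WF.qform)

/-! ## §1 Channel inequalities on momentum-zero near-minimisers; the relaxed floating bound -/

/-- **Particle channel on momentum-zero near-minimisers** (threshold `T`, bound `b`): for every `η > 0` there is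
`δ > 0` such that every `δ`-near-minimiser `Ψ` of `H_{m+2}` of TOTAL MOMENTUM ZERO obeys, with `a† = a†(φ_n)`,
`‖a†ψ‖² = n_k + 1`, `(n_k+1)² ≤ b·((1+η)(𝓔[a†ψ] − T(n_k+1)) + η(n_k+1))`. `ChanPlus` (v7) restricted to
`HasTotalMomentum 0 Ψ.ψ`; on such `Ψ` the test vector `a†ψ` has total momentum `2πn/L` exactly. [cite: KLS1988JSP, (12)] -/
def ChanPlusZero (v : ℝ → ℝ≥0∞) (m : ℕ) (L : ℝ) (n : Fin 3 → ℤ) (T b : ℝ) : Prop :=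
  ∀ η : ℝ, 0 < η → ∃ δ : ℝ≥0∞, 0 < δ ∧ ∀ Ψ : PeriodicTrialState (m + 2) L, NearMinAt v δ Ψ →
    HasTotalMomentum 0 Ψ.ψ →
      let nk : ℝ := (cellOccupation (m + 2) L (planeWaveMode L n) Ψ.ψ).toReal
      let qC : ℝ := (WF.qform v L (modeCr (planeWaveMode L n) Ψ.ψ)).toReal
      (nk + 1) ^ 2 ≤ b * ((1 + η) * (qC - T * (nk + 1)) + η * (nk + 1))

/-- **Hole channel on momentum-zero near-minimisers** (threshold `T`, bound `b`; `‖a(φ_n)ψ‖² = n_k`):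
`n_k² ≤ b·((1+η)(𝓔[aψ] − T·n_k) + η·n_k)` for momentum-zero `δ`-near-minimisers. [cite: KLS1988JSP, (12)] -/
def ChanMinusZero (v : ℝ → ℝ≥0∞) (m : ℕ) (L : ℝ) (n : Fin 3 → ℤ) (T b : ℝ) : Prop :=
  ∀ η : ℝ, 0 < η → ∃ δ : ℝ≥0∞, 0 < δ ∧ ∀ Ψ : PeriodicTrialState (m + 2) L, NearMinAt v δ Ψ →
    HasTotalMomentum 0 Ψ.ψ →
      let nk : ℝ := (cellOccupation (m + 2) L (planeWaveMode L n) Ψ.ψ).toReal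
      let qA : ℝ := (WF.qform v L (modeAn L (planeWaveMode L n) Ψ.ψ)).toReal
      nk ^ 2 ≤ b * ((1 + η) * (qA - T * nk) + η * nk)

/-- **The relaxed floating two-channel bound on momentum-zero near-minimisers, for ONE potential with data
`(K, ρ₀, C, A)`**, read along `L = L_N(ρ) = (N/ρ)^{1/3}`, `N = m + 2`: for every slack `ε > 0` and density `ρ < ρ₀`,
eventually in `N`, for every mode `0 < 2π‖n‖_∞/L ≤ K` there are `μ₊ ≥ −Aρ` and `μ₋ ≤ μ₊ + ε√(ρa)/L` such that both
momentum-zero channel inequalities hold at sector `N` with bound `b = CL²/‖n‖²_∞` against `E₀(N) + μ₊` (particle) and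
`E₀(N) − μ₋` (hole). `FloatingFor v K ρ₀ C` (v7) is the case `A = 0` with unrestricted near-minimisers. A statement of
the proof plan, not a result in print. -/
def FloatingForZero (v : ℝ → ℝ≥0∞) (K ρ₀ C A : ℝ) : Prop :=
  ∀ ε : ℝ, 0 < ε → ∀ ρ : ℝ, 0 < ρ → ρ < ρ₀ → ∀ᶠ m : ℕ in atTop,
    ∀ n : Fin 3 → ℤ, n ≠ 0 → 2 * Real.pi / sideLength ρ (m + 2) * ‖(fun j => (n j : ℝ))‖ ≤ K →
      ∃ μp μm : ℝ, -(A * ρ) ≤ μp ∧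
        μm ≤ μp + ε * Real.sqrt (ρ * (scatteringLength v).toReal) / sideLength ρ (m + 2) ∧
        ChanPlusZero v m (sideLength ρ (m + 2)) n
            ((periodicGroundStateEnergy v (m + 2) (sideLength ρ (m + 2))).toReal + μp)
            (C * sideLength ρ (m + 2) ^ 2 / ‖(fun j => (n j : ℝ))‖ ^ 2) ∧
          ChanMinusZero v m (sideLength ρ (m + 2)) n
            ((periodicGroundStateEnergy v (m + 2) (sideLength ρ (m + 2))).toReal - μm)
            (C * sideLength ρ (m + 2) ^ 2 / ‖(fun j => (n j : ℝ))‖ ^ 2)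

/-- **Stub S1₀ statement — the pooled load of v9 (open-problem strength)**: every integrable admissible `v` admits
data `K, ρ₀, C > 0`, `A ≥ 0` with `FloatingForZero v K ρ₀ C A`. Implied by S1' `FloatingTwoChannel`
(`floatingTwoChannelZero_of_floatingTwoChannel`), hence by stmt-12620 ∧ stmt-9094 (`floatingTwoChannelZero_of_pooled`),
and by line 1's `LinearParticleHoleFloor` (`floatingTwoChannelZero_of_linearFloor`, modulo S9, S9'); implies the integrable
half of the crux (`integrableHalf_of_floatingZero`, modulo S4₀, S5₀), hence torus thermodynamic-limit BEC for integrable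
`v` (`…DifficultyFloorR2`). Free-gas instance: `μ₊ = μ₋ = 0`, every `C ≥ 1/(4π²)` (p154826). A statement of the proof
plan, not a result in print. -/
def FloatingTwoChannelZero : Prop :=
  ∀ v : ℝ → ℝ≥0∞, IsRepulsiveFiniteRange v → (∫⁻ x : Space, v ‖x‖) ≠ ⊤ →
    ∃ K : ℝ, 0 < K ∧ ∃ ρ₀ : ℝ, 0 < ρ₀ ∧ ∃ C : ℝ, 0 < C ∧ ∃ A : ℝ, 0 ≤ A ∧ FloatingForZero v K ρ₀ C A

/-! ## §2 Statements of the v9 stubs -/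

/-- **The KLS moment inequality with free thresholds on momentum-zero near-minimisers, for ONE potential**: the v7
`KLSMomentForT v` with the channel hypotheses weakened to `ChanPlusZero` / `ChanMinusZero` and the conclusion asked only
for near-minimisers of total momentum zero. Proof plan: `KLS.klsMomentForT` (p152976) verbatim, the momentum hypothesis
threaded into `hchanP`, `hchanM`. [cite: KLS1988JSP, (12)–(14); Wagner1966, §2] -/
def KLSMomentForTZero (v : ℝ → ℝ≥0∞) : Prop :=
  ∀ (m : ℕ) (L : ℝ), 0 < L → periodicGroundStateEnergy v (m + 2) L ≠ ⊤ →
    ∀ n : Fin 3 → ℤ, n ≠ 0 → ∀ b : ℝ, 0 ≤ b → ∀ Tp Tm : ℝ, ChanPlusZero v m L n Tp b → ChanMinusZero v m L n Tm b →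
      ∀ η : ℝ, 0 < η → ∃ δ : ℝ≥0∞, 0 < δ ∧ ∀ Ψ : PeriodicTrialState (m + 2) L, NearMinAt v δ Ψ →
        HasTotalMomentum 0 Ψ.ψ →
          let nk : ℝ := (cellOccupation (m + 2) L (planeWaveMode L n) Ψ.ψ).toReal
          (2 * nk + 1) ^ 2 ≤
            2 * b * ((1 + η) * (‖latticeVec (2 * Real.pi / L) n‖ ^ 2 +
                2 * ((m : ℝ) + 2) * (∫⁻ x : Space, v ‖x‖).toReal / L ^ 3 +
                (periodicGroundStateEnergy v (m + 2) L).toReal * (2 * nk + 1) - Tm * nk - Tp * (nk + 1)) +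
              η * (2 * nk + 2))

/-- **Stub S4₀ statement**: `KLSMomentForTZero v` for every integrable admissible `v` (provable now). -/
def KLSNearMinimiserTZero : Prop :=
  ∀ v : ℝ → ℝ≥0∞, IsRepulsiveFiniteRange v → (∫⁻ x : Space, v ‖x‖) ≠ ⊤ → KLSMomentForTZero v

/-- **The crux's infrared inequality for near-minimisers of TOTAL MOMENTUM ZERO, for ONE potential** — exactly the
hypothesis shape of the landed normal form `stub_momentumZeroReduction` (p156444), with `ρ₀, C` existential. [folklore] -/
def IRBoundForZero (v : ℝ → ℝ≥0∞) : Prop :=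
  ∀ κ : ℝ, 0 < κ → ∃ ρ₀ : ℝ, 0 < ρ₀ ∧ ∃ C : ℝ, 0 < C ∧ ∀ ρ : ℝ, 0 < ρ → ρ < ρ₀ →
    ∀ᶠ N : ℕ in atTop, ∃ δ : ℝ≥0∞, 0 < δ ∧ ∀ Ψ : PeriodicTrialState N (sideLength ρ N),
      NearMin v ρ N δ Ψ → HasTotalMomentum 0 Ψ.ψ → ∀ k : Fin 3 → ℤ, InWindow κ ρ N k → IRIneq C ρ N Ψ.ψ k

/-- **Stub S5₀ statement — window arithmetic and the scalar endgame on momentum-zero states, relaxed guard**: for an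
integrable admissible `v`, `FloatingForZero v K ρ₀ C A` and `KLSMomentForTZero v` give `IRBoundForZero v`. Proof plan: the
landed S5' `stub_windowAssemblyT` (p153397) verbatim with (a) the momentum hypothesis threaded, (b) the guard `−Aρ ≤ μ₊`
absorbed: the energy combination is `≤ e·n_k + Aρ`, so `WindowArith.nk_le` is called with `W + Aρ` in place of `W` and
`V₁ + A/2` in place of `V₁ = ‖v‖₁` (`D + Aρ ≤ 12π²‖n‖²/L² + 2ρ(V₁ + A/2)`), constant
`C√a + 2κ + √((12π²C+1)κ² + 2C(‖v‖₁ + A/2))`. A statement of the proof plan, not a result in print. -/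
def WindowAssemblyTZero : Prop :=
  ∀ v : ℝ → ℝ≥0∞, IsRepulsiveFiniteRange v → (∫⁻ x : Space, v ‖x‖) ≠ ⊤ →
    ∀ K ρ₀ C A : ℝ, 0 < K → 0 < ρ₀ → 0 < C → 0 ≤ A →
      FloatingForZero v K ρ₀ C A → KLSMomentForTZero v → IRBoundForZero v

/-- **Stub S9 statement — line 1's `C⁺` gives the v9 load, per potential with `∫v ≠ 0`** (strategist s2, census v3
§1.4, typed there as `StrategistS2.LinearFloorGivesFloating`; here on momentum-zero states, where it is direct). Plan:
(1) `C⁺ ⇒ IRBoundFor v` with some `C_X` (LANDED: `Transfer` = `stub_wagnerFeynman` + `TransferArith`), read on momentum-zero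
near-minimisers; (2) for a momentum-zero near-minimiser `Ψ` the test vectors `a†(φ_n)Ψ`, `a(φ_n)Ψ` have total momentum
`±p`, `p = 2πn/L` (`WF.hasTotalMomentum_modeCr/_modeAn`), so `𝓔[a†Ψ] ≥ E_{N+1}(p)(n_k+1)` and `𝓔[aΨ] ≥ E_{N−1}(−p)n_k
= E_{N−1}(p)n_k` (`WF.momentumSectorEnergy_mul_normSq_le`, `momentumSectorEnergy_neg`); (3) with `b = C'L²/‖n‖²`,
`C'` large, `(2n_k+1)/b ≤ 2θ√ρ‖p‖ ≤ E_{N+1}(p) + E_{N−1}(p) − 2E₀(N)` (the floor, window `‖p‖² ≤ 12π²κ²ρ`), so some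
`μ := μ₊ = μ₋` has `E_{N+1}(p) − E₀ − μ ≥ (n_k+1)/b` and `E₀ − E_{N−1}(p) + μ ≤ -n_k/b`… i.e. both shares, whence
`ChanPlusZero`/`ChanMinusZero` with `η`-slack to spare; (4) `μ ≥ E₀ − E_{N−1}(p) + n_k/b ≥ E₀(N) − E₀(N−1) ≥ 0`? — only
`μ ≥ −(n_k+1)/b ≥ −Aρ` is guaranteed on the window (`E_{N+1}(p) ≥ E₀(N+1) ≥ E₀(N)`), which is where the relaxed guard
is used. A statement of the proof plan, not a result in print. -/
def LinearFloorGivesFloatingZero : Prop :=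
  ∀ v : ℝ → ℝ≥0∞, IsRepulsiveFiniteRange v → (∫⁻ x : Space, v ‖x‖) ≠ ⊤ → (∫⁻ x : Space, v ‖x‖) ≠ 0 →
    LinearFloorFor v → ∃ K : ℝ, 0 < K ∧ ∃ ρ₀ : ℝ, 0 < ρ₀ ∧ ∃ C : ℝ, 0 < C ∧ ∃ A : ℝ, 0 ≤ A ∧
      FloatingForZero v K ρ₀ C A

/-- **Stub S9' statement — the a.e.-free potentials**: an admissible `v` with `∫ v(|x|)dx = 0` (i.e. `v(|·|) = 0` a.e.)
carries the v9 load. Plan: c22's free-gas instance `floatingFor_zero` (p154826: `FloatingFor 0 K ρ₀ C` for every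
`C ≥ 1/(4π²)`, `μ₊ = μ₋ = 0`) transported along the a.e.-class of `v ∘ |·|` (`Negative.AEClass`:
`periodicEnergy_congr_ae`, `periodicGroundStateEnergy_congr_ae`, `periodicInteraction_congr_ae`; the coupling term only
needs `0 ≤ ε√(ρa)/L`), then `floatingForZero_of_floatingFor`. A statement of the proof plan (provable now), not a
result in print. -/
def AeZeroFloating : Prop :=
  ∀ v : ℝ → ℝ≥0∞, IsRepulsiveFiniteRange v → (∫⁻ x : Space, v ‖x‖) = 0 →
    ∃ K : ℝ, 0 < K ∧ ∃ ρ₀ : ℝ, 0 < ρ₀ ∧ ∃ C : ℝ, 0 < C ∧ ∃ A : ℝ, 0 ≤ A ∧ FloatingForZero v K ρ₀ C A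

/-! ## §3 Sorry-free glue -/

/-- Restriction: the v7 particle channel implies the momentum-zero one. [folklore] -/
theorem chanPlusZero_of_chanPlus {v : ℝ → ℝ≥0∞} {m : ℕ} {L : ℝ} {n : Fin 3 → ℤ} {T b : ℝ}
    (h : ChanPlus v m L n T b) : ChanPlusZero v m L n T b := by
  intro η hη
  obtain ⟨δ, hδ, hΨ⟩ := h η hη
  exact ⟨δ, hδ, fun Ψ hnear _ => hΨ Ψ hnear⟩

/-- Restriction: the v7 hole channel implies the momentum-zero one. [folklore] -/
theorem chanMinusZero_of_chanMinus {v : ℝ → ℝ≥0∞} {m : ℕ} {L : ℝ} {n : Fin 3 → ℤ} {T b : ℝ}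
    (h : ChanMinus v m L n T b) : ChanMinusZero v m L n T b := by
  intro η hη
  obtain ⟨δ, hδ, hΨ⟩ := h η hη
  exact ⟨δ, hδ, fun Ψ hnear _ => hΨ Ψ hnear⟩

/-- Lowering the threshold weakens the momentum-zero particle channel (`b ≥ 0`). [folklore] -/
theorem chanPlusZero_antitone {v : ℝ → ℝ≥0∞} {m : ℕ} {L : ℝ} {n : Fin 3 → ℤ} {T T' b : ℝ} (hb : 0 ≤ b)
    (hT : T' ≤ T) (h : ChanPlusZero v m L n T b) : ChanPlusZero v m L n T' b := by
  intro η hη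
  obtain ⟨δ, hδ, hΨ⟩ := h η hη
  refine ⟨δ, hδ, fun Ψ hnear h0 => ?_⟩
  have key := hΨ Ψ hnear h0
  simp only at key ⊢
  have hnk : 0 ≤ (cellOccupation (m + 2) L (planeWaveMode L n) Ψ.ψ).toReal + 1 := by positivity
  have hmono : T' * ((cellOccupation (m + 2) L (planeWaveMode L n) Ψ.ψ).toReal + 1) ≤
      T * ((cellOccupation (m + 2) L (planeWaveMode L n) Ψ.ψ).toReal + 1) :=
    mul_le_mul_of_nonneg_right hT hnk
  have h1η : 0 ≤ 1 + η := by linarith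
  nlinarith [mul_le_mul_of_nonneg_left (mul_le_mul_of_nonneg_left (sub_le_sub_left hmono
    ((WF.qform v L (modeCr (planeWaveMode L n) Ψ.ψ)).toReal)) h1η) hb]

/-- Lowering the threshold weakens the momentum-zero hole channel (`b ≥ 0`). [folklore] -/
theorem chanMinusZero_antitone {v : ℝ → ℝ≥0∞} {m : ℕ} {L : ℝ} {n : Fin 3 → ℤ} {T T' b : ℝ} (hb : 0 ≤ b)
    (hT : T' ≤ T) (h : ChanMinusZero v m L n T b) : ChanMinusZero v m L n T' b := by
  intro η hη
  obtain ⟨δ, hδ, hΨ⟩ := h η hη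
  refine ⟨δ, hδ, fun Ψ hnear h0 => ?_⟩
  have key := hΨ Ψ hnear h0
  simp only at key ⊢
  have hnk : 0 ≤ (cellOccupation (m + 2) L (planeWaveMode L n) Ψ.ψ).toReal := ENNReal.toReal_nonneg
  have hmono : T' * (cellOccupation (m + 2) L (planeWaveMode L n) Ψ.ψ).toReal ≤
      T * (cellOccupation (m + 2) L (planeWaveMode L n) Ψ.ψ).toReal :=
    mul_le_mul_of_nonneg_right hT hnk
  have h1η : 0 ≤ 1 + η := by linarith
  nlinarith [mul_le_mul_of_nonneg_left (mul_le_mul_of_nonneg_left (sub_le_sub_left hmono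
    ((WF.qform v L (modeAn L (planeWaveMode L n) Ψ.ψ)).toReal)) h1η) hb]

/-- The v7 floating bound implies the v9 one (any `A ≥ 0`). [folklore] -/
theorem floatingForZero_of_floatingFor {v : ℝ → ℝ≥0∞} {K ρ₀ C A : ℝ} (hA : 0 ≤ A)
    (h : FloatingFor v K ρ₀ C) : FloatingForZero v K ρ₀ C A := by
  intro ε hε ρ hρ hρρ₀
  filter_upwards [h ε hε ρ hρ hρρ₀] with m hm n hn hK
  obtain ⟨μp, μm, hμp, hμm, hP, hM⟩ := hm n hn hK
  exact ⟨μp, μm, by nlinarith [mul_nonneg hA hρ.le], hμm, chanPlusZero_of_chanPlus hP,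
    chanMinusZero_of_chanMinus hM⟩

/-- Monotonicity of the v9 bound in `A`. [folklore] -/
theorem floatingForZero_mono_A {v : ℝ → ℝ≥0∞} {K ρ₀ C A A' : ℝ} (hA : A ≤ A')
    (h : FloatingForZero v K ρ₀ C A) : FloatingForZero v K ρ₀ C A' := by
  intro ε hε ρ hρ hρρ₀
  filter_upwards [h ε hε ρ hρ hρρ₀] with m hm n hn hK
  obtain ⟨μp, μm, hμp, hμm, hP, hM⟩ := hm n hn hK
  exact ⟨μp, μm, by nlinarith [mul_le_mul_of_nonneg_right hA hρ.le], hμm, hP, hM⟩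

/-- **S1' ⇒ S1₀**: the v8 pooled stub implies the v9 one. [folklore] -/
theorem floatingTwoChannelZero_of_floatingTwoChannel (h : FloatingTwoChannel) : FloatingTwoChannelZero := by
  intro v hv hint
  obtain ⟨K, hK, ρ₀, hρ₀, C, hC, hF⟩ := h v hv hint
  exact ⟨K, hK, ρ₀, hρ₀, C, hC, 0, le_rfl, floatingForZero_of_floatingFor le_rfl hF⟩

/-- **stmt-12620 ∧ stmt-9094 ⇒ S1₀** (through S1', `stub_floatingOfPooled` p155164). [folklore] -/
theorem floatingTwoChannelZero_of_pooled (hGD : GaussianDomination) (hC : EnergyConvexityWindow) :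
    FloatingTwoChannelZero :=
  floatingTwoChannelZero_of_floatingTwoChannel (stub_floatingOfPooled hGD hC)

/-- **Momentum-zero near-minimisers suffice** (the landed normal form p156444, constants `C ↦ 2C`): for an integrable
admissible `v`, `IRBoundForZero v → IRBoundFor v`. [folklore] -/
theorem irBoundFor_of_irBoundForZero {v : ℝ → ℝ≥0∞} (hv : IsRepulsiveFiniteRange v)
    (hint : (∫⁻ x : Space, v ‖x‖) ≠ ⊤) (h : IRBoundForZero v) : IRBoundFor v := by
  rw [irBoundFor_iff]
  intro κ hκ
  obtain ⟨ρ₀, hρ₀, C, hC, hyp⟩ := h κ hκ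
  exact ⟨ρ₀, hρ₀, 2 * C, by positivity, stub_momentumZeroReduction v hv hint κ ρ₀ C hκ hC hyp⟩

/-- **The integrable half of the crux from S1₀, S4₀, S5₀.** [folklore] -/
theorem integrableHalf_of_floatingZero (h1 : FloatingTwoChannelZero) (h4 : KLSNearMinimiserTZero)
    (h5 : WindowAssemblyTZero) :
    ∀ v : ℝ → ℝ≥0∞, IsRepulsiveFiniteRange v → (∫⁻ x : Space, v ‖x‖) ≠ ⊤ → IRBoundFor v := by
  intro v hv hint
  obtain ⟨K, hK, ρ₀, hρ₀, C, hC, A, hA, hF⟩ := h1 v hv hint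
  exact irBoundFor_of_irBoundForZero hv hint (h5 v hv hint K ρ₀ C A hK hρ₀ hC hA hF (h4 v hv hint))

/-- **Registered by-product `stub_integrableHalfOfFloatingZero` of the crux ledger** (line `two-sector-gd-transfer`,
v9): S1₀ ∧ S4₀ ∧ S5₀ give `IRBoundFor v` for every INTEGRABLE admissible `v`. [folklore] -/
theorem stub_integrableHalfOfFloatingZero :
    FloatingTwoChannelZero → KLSNearMinimiserTZero → WindowAssemblyTZero →
      ∀ v : ℝ → ℝ≥0∞, IsRepulsiveFiniteRange v → (∫⁻ x : Space, v ‖x‖) ≠ ⊤ → IRBoundFor v :=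
  integrableHalf_of_floatingZero

/-- **`PeriodicIRBound` by name from S1₀, S4₀, S5₀ and the scope half S6 `NonIntegrableHalf`.** [folklore] -/
theorem periodicIRBound_of_floatingZero (h1 : FloatingTwoChannelZero) (h4 : KLSNearMinimiserTZero)
    (h5 : WindowAssemblyTZero) (h6 : NonIntegrableHalf) : PeriodicIRBound :=
  periodicIRBound_iff_split.2 ⟨integrableHalf_of_floatingZero h1 h4 h5, h6⟩

/-- **Line 1's `C⁺` gives S1₀** (modulo S9 for `∫v ≠ 0` and S9' for `∫v = 0`). [folklore] -/
theorem floatingTwoChannelZero_of_linearFloor (h9 : LinearFloorGivesFloatingZero) (h9' : AeZeroFloating)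
    (hC : LinearParticleHoleFloor) : FloatingTwoChannelZero := by
  intro v hv hint
  by_cases h0 : (∫⁻ x : Space, v ‖x‖) = 0
  · exact h9' v hv h0
  · exact h9 v hv hint h0 (hC v hv h0)

end Summit.AtomisticToContinuum.BoseEinsteinCondensation.Cruxes.PeriodicIRBound.TwoSectorGdTransfer

end
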